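import Summits.Ventures.PercRepro.RankLevelSetUpClassCutDecomp

/-! # RankLevelSetUpPieces — THE BI-SPANNING SETS SORTED BY THEIR TRACE ON A PARALLEL CLASS, AT EVERY LEVEL
(night-1 g39; dossier §51.8–51.10; on `RankLevelSetUpClassCutDecomp`)

For a loopless matroid `N`, the class `P = cl {p}` of size `q`, `E' = E ∖ P` and `b ∉ P`, the bi-spanning `k`-sets
through `b` (resp. avoiding `b`) meeting `P` in exactly `s` elements are in bijection with `{S ⊆ P : #S = s} ×`
the level-`(k − s)` through-`b` (resp. avoid-`b`) family of the contraction — `throughHat` / `avoidHat` when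
`1 ≤ s < q` (the complement keeps an element of the class, so «spanning» means «spanning with `p`» on both sides:
**`pieceThrough_ncard`**, **`pieceAvoid_ncard`**), the mixed family `upFull` / `avoidFull` when `s = 0`
(**`pieceThrough_zero_ncard`**, **`pieceAvoid_zero_ncard`**), and the new families **`throughSp`** / **`avoidSp`**
(«spanning with `p`, complement spanning WITHOUT `p`») when `s = q` (**`pieceThrough_top_ncard`**,
**`pieceAvoid_top_ncard`**). These are the exact terms of the decompositions `T_k = Σ_s C(q,s)·g_{k−s}` and
`V_{k+1} = Σ_s C(q,s)·ḡ_{k+1−s}` used by the class-cut reductions at every level. Every declaration has a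
docstring; imports: the cell's own modules and Mathlib only. Axioms: standard. -/

namespace PercRepro

open Set Matroid

variable {α : Type} (N : Matroid α) [N.Finite]

/-! ## The two «spanning without `p`» families -/

/-- **The through-`b` `k`-sets spanning with `p` whose complement spans without `p`** (`g_k^{sp}`): `U ⊆ E ∖ cl {p}`,
`#U = k`, `b ∈ U`, `insert p U` spanning and `(E ∖ cl {p}) ∖ U` spanning `N`. -/
def throughSp (p b : α) (k : ℕ) : Set (Set α) :=
  {U | U ⊆ N.E \ N.closure {p} ∧ U.ncard = k ∧ b ∈ U ∧ N.Spanning (insert p U) ∧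
    N.Spanning ((N.E \ N.closure {p}) \ U)}

/-- **The avoid-`b` `k`-sets spanning with `p` whose complement spans without `p`** (`ḡ_k^{sp}`). -/
def avoidSp (p b : α) (k : ℕ) : Set (Set α) :=
  {D | D ⊆ N.E \ N.closure {p} ∧ D.ncard = k ∧ b ∉ D ∧ N.Spanning (insert p D) ∧
    N.Spanning ((N.E \ N.closure {p}) \ D)}

/-- The two families are finite. -/
lemma throughSp_finite (p b : α) (k : ℕ) : (throughSp N p b k).Finite :=
  (N.ground_finite.subset Set.sdiff_subset).finite_subsets.subset (fun _ h => h.1)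

/-- The two families are finite. -/
lemma avoidSp_finite (p b : α) (k : ℕ) : (avoidSp N p b k).Finite :=
  (N.ground_finite.subset Set.sdiff_subset).finite_subsets.subset (fun _ h => h.1)

omit [N.Finite] in
/-- `g_k^{sp} ⊆ g_k`: a complement spanning without `p` spans with `p`. -/
lemma throughSp_subset_throughHat (p b : α) (k : ℕ) : throughSp N p b k ⊆ throughHat N p b k := by
  rintro U ⟨h1, h2, h3, h4, h5⟩
  refine ⟨h1, h2, h3, h4, h5.superset (Set.subset_insert p _) ?_⟩
  exact Set.insert_subset (h4.subset_ground (Set.mem_insert p U)) (Set.sdiff_subset.trans Set.sdiff_subset)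

omit [N.Finite] in
/-- `ḡ_k^{sp} ⊆ ḡ_k`. -/
lemma avoidSp_subset_avoidHat (p b : α) (k : ℕ) : avoidSp N p b k ⊆ avoidHat N p b k := by
  rintro D ⟨h1, h2, h3, h4, h5⟩
  refine ⟨h1, h2, h3, h4, h5.superset (Set.subset_insert p _) ?_⟩
  exact Set.insert_subset (h4.subset_ground (Set.mem_insert p D)) (Set.sdiff_subset.trans Set.sdiff_subset)

/-! ## The pieces -/

/-- **The through-`b` bi-spanning `k`-sets meeting the class in exactly `s` elements.** -/
def pieceThrough (p b : α) (k s : ℕ) : Set (Set α) :=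
  {W ∈ biSpan N k | b ∈ W ∧ (W ∩ N.closure {p}).ncard = s}

/-- **The avoid-`b` bi-spanning `k`-sets meeting the class in exactly `s` elements.** -/
def pieceAvoid (p b : α) (k s : ℕ) : Set (Set α) :=
  {Z ∈ biSpan N k | b ∉ Z ∧ (Z ∩ N.closure {p}).ncard = s}

/-- The pieces are finite. -/
lemma pieceThrough_finite (p b : α) (k s : ℕ) : (pieceThrough N p b k s).Finite :=
  N.ground_finite.finite_subsets.subset (fun _ h => h.1.1)

/-- The pieces are finite. -/
lemma pieceAvoid_finite (p b : α) (k s : ℕ) : (pieceAvoid N p b k s).Finite :=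
  N.ground_finite.finite_subsets.subset (fun _ h => h.1.1)

omit [N.Finite] in
/-- The complement of `W` splits along `P` as `((E ∖ P) ∖ (W ∖ P)) ∪ (P ∖ W)`. -/
lemma compl_eq_sdiff_union {P W : Set α} (hPE : P ⊆ N.E) :
    N.E \ W = ((N.E \ P) \ (W \ P)) ∪ (P \ W) := by
  ext y
  simp only [Set.mem_sdiff, Set.mem_union, not_and, not_not]
  constructor
  · rintro ⟨hyE, hyW⟩
    by_cases hyP : y ∈ P
    · exact Or.inr ⟨hyP, hyW⟩
    · exact Or.inl ⟨⟨hyE, hyP⟩, fun h => absurd h hyW⟩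
  · rintro (⟨⟨hyE, hyP⟩, h⟩ | ⟨hyP, hyW⟩)
    · exact ⟨hyE, fun hyW => hyP (h hyW)⟩
    · exact ⟨hPE hyP, hyW⟩

omit [N.Finite] in
/-- `(U ∪ S) ∩ P = S` and `(U ∪ S) ∖ P = U` for `U ⊆ E ∖ P`, `S ⊆ P`. -/
lemma union_inter_eq_and_sdiff_eq {P U S : Set α} (hU : U ⊆ N.E \ P) (hS : S ⊆ P) :
    (U ∪ S) ∩ P = S ∧ (U ∪ S) \ P = U := by
  constructor
  · ext x; simp only [Set.mem_inter_iff, Set.mem_union]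
    constructor
    · rintro ⟨hx | hx, hxP⟩
      · exact absurd hxP (hU hx).2
      · exact hx
    · intro hx; exact ⟨Or.inr hx, hS hx⟩
  · ext x; simp only [Set.mem_sdiff, Set.mem_union]
    constructor
    · rintro ⟨hx | hx, hxP⟩
      · exact hx
      · exact absurd (hS hx) hxP
    · intro hx; exact ⟨Or.inl hx, (hU hx).2⟩

/-- **THE MIDDLE PIECES, THROUGH `b`**: for `1 ≤ s < q`, `W ↦ (W ∩ P, W ∖ P)` is a bijection from the through-`b`
bi-spanning `k`-sets meeting `P` in `s` elements onto `{S ⊆ P : #S = s} × g_{k−s}`: the piece has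
`C(q,s) · g_{k−s}` members. -/
theorem pieceThrough_ncard (hnl : ∀ e ∈ N.E, N.IsNonloop e) {p : α} (hp : p ∈ N.E) {b : α}
    (hbP : b ∉ N.closure {p}) {k s : ℕ} (hs1 : 1 ≤ s) (hsq : s < (N.closure {p}).ncard) (hsk : s ≤ k) :
    (pieceThrough N p b k s).ncard = (N.closure {p}).ncard.choose s * (throughHat N p b (k - s)).ncard := by
  classical
  set P := N.closure {p} with hPdef
  have hPE : P ⊆ N.E := N.closure_subset_ground _
  have hpnl : N.IsNonloop p := hnl p hp
  have hPfin : P.Finite := N.ground_finite.subset hPE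
  rw [← Set.ncard_powerset_ncard hPfin s, ← Set.ncard_prod]
  refine Set.ncard_congr (fun W _ => (W ∩ P, W \ P)) ?_ ?_ ?_
  · rintro W ⟨⟨hWE, hWk, hWs, hWc⟩, hbW, hWP⟩
    rw [← hPdef] at hWP
    have hWfin : W.Finite := N.ground_finite.subset hWE
    have hSne : (W ∩ P).Nonempty := by
      rw [← Set.ncard_pos (hWfin.subset Set.inter_subset_left)]; omega
    have hPWne : (P \ W).Nonempty := by
      by_contra hemp
      rw [Set.not_nonempty_iff_eq_empty, Set.sdiff_eq_empty] at hemp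
      have : P ⊆ W ∩ P := fun y hy => ⟨hemp hy, hy⟩
      have hle := Set.ncard_le_ncard this (hWfin.subset Set.inter_subset_left)
      omega
    refine Set.mem_prod.mpr ⟨⟨Set.inter_subset_right, hWP⟩, ?_, ?_, ⟨hbW, hbP⟩, ?_, ?_⟩
    · intro y hy; exact ⟨hWE hy.1, hy.2⟩
    · have h := Set.ncard_inter_add_ncard_sdiff_eq_ncard W P hWfin
      rw [hWP, hWk] at h
      show (W \ P).ncard = k - s
      omega
    · have hW' : W = (W \ P) ∪ (W ∩ P) := by rw [Set.sdiff_union_inter]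
      rw [hW'] at hWs
      exact spanning_insert_of_spanning_union N hp Set.inter_subset_right (Set.sdiff_subset.trans hWE) hWs
    · rw [compl_eq_sdiff_union N hPE] at hWc
      exact spanning_insert_of_spanning_union N hp Set.sdiff_subset
        (Set.sdiff_subset.trans Set.sdiff_subset) hWc
  · intro W W' _ _ heq
    simp only [Prod.mk.injEq] at heq
    rw [← Set.inter_union_sdiff W P, ← Set.inter_union_sdiff W' P, heq.1, heq.2]
  · rintro ⟨S, U⟩ hx
    obtain ⟨hx1, hx2⟩ := Set.mem_prod.mp hx
    dsimp only at hx1 hx2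
    obtain ⟨hSP, hSs⟩ := hx1
    obtain ⟨hUE, hUk, hbU, hUs, hUc⟩ := hx2
    have hUfin : U.Finite := N.ground_finite.subset (hUE.trans Set.sdiff_subset)
    have hSfin : S.Finite := hPfin.subset hSP
    have hdj : Disjoint U S := by
      rw [Set.disjoint_left]; intro x hxU hxS; exact (hUE hxU).2 (hSP hxS)
    have hSne : S.Nonempty := by rw [← Set.ncard_pos hSfin]; omega
    have hPSne : (P \ S).Nonempty := by
      by_contra hemp
      rw [Set.not_nonempty_iff_eq_empty, Set.sdiff_eq_empty] at hemp
      have := Set.ncard_le_ncard hemp hSfin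
      omega
    obtain ⟨hi, hd⟩ := union_inter_eq_and_sdiff_eq N hUE hSP
    refine ⟨U ∪ S, ⟨⟨Set.union_subset (hUE.trans Set.sdiff_subset) (hSP.trans hPE), ?_, ?_, ?_⟩,
      Or.inl hbU, by rw [hi, hSs]⟩, ?_⟩
    · rw [Set.ncard_union_eq hdj hUfin hSfin, hUk, hSs]; omega
    · exact (spanning_union_iff_insert N hnl hpnl hSP hSne (hUE.trans Set.sdiff_subset)).mpr hUs
    · rw [compl_union_eq N hPE hUE hSP]
      exact (spanning_union_iff_insert N hnl hpnl Set.sdiff_subset hPSne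
        (Set.sdiff_subset.trans Set.sdiff_subset)).mpr hUc
    · simp only [Prod.mk.injEq]; exact ⟨hi, hd⟩

/-- **THE MIDDLE PIECES, AVOIDING `b`**: for `1 ≤ s < q`, the avoid-`b` bi-spanning `k`-sets meeting `P` in `s`
elements number `C(q,s) · ḡ_{k−s}` (`Z ↦ (Z ∩ P, Z ∖ P)`). -/
theorem pieceAvoid_ncard (hnl : ∀ e ∈ N.E, N.IsNonloop e) {p : α} (hp : p ∈ N.E) {b : α}
    (hbP : b ∉ N.closure {p}) {k s : ℕ} (hs1 : 1 ≤ s) (hsq : s < (N.closure {p}).ncard) (hsk : s ≤ k) :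
    (pieceAvoid N p b k s).ncard = (N.closure {p}).ncard.choose s * (avoidHat N p b (k - s)).ncard := by
  classical
  set P := N.closure {p} with hPdef
  have hPE : P ⊆ N.E := N.closure_subset_ground _
  have hpnl : N.IsNonloop p := hnl p hp
  have hPfin : P.Finite := N.ground_finite.subset hPE
  rw [← Set.ncard_powerset_ncard hPfin s, ← Set.ncard_prod]
  refine Set.ncard_congr (fun Z _ => (Z ∩ P, Z \ P)) ?_ ?_ ?_
  · rintro Z ⟨⟨hZE, hZk, hZs, hZc⟩, hbZ, hZP⟩
    rw [← hPdef] at hZP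
    have hZfin : Z.Finite := N.ground_finite.subset hZE
    have hSne : (Z ∩ P).Nonempty := by
      rw [← Set.ncard_pos (hZfin.subset Set.inter_subset_left)]; omega
    refine Set.mem_prod.mpr ⟨⟨Set.inter_subset_right, hZP⟩, ?_, ?_, fun h => hbZ h.1, ?_, ?_⟩
    · intro y hy; exact ⟨hZE hy.1, hy.2⟩
    · have h := Set.ncard_inter_add_ncard_sdiff_eq_ncard Z P hZfin
      rw [hZP, hZk] at h
      show (Z \ P).ncard = k - s
      omega
    · have hZ' : Z = (Z \ P) ∪ (Z ∩ P) := by rw [Set.sdiff_union_inter]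
      rw [hZ'] at hZs
      exact spanning_insert_of_spanning_union N hp Set.inter_subset_right (Set.sdiff_subset.trans hZE) hZs
    · rw [compl_eq_sdiff_union N hPE] at hZc
      exact spanning_insert_of_spanning_union N hp Set.sdiff_subset
        (Set.sdiff_subset.trans Set.sdiff_subset) hZc
  · intro Z Z' _ _ heq
    simp only [Prod.mk.injEq] at heq
    rw [← Set.inter_union_sdiff Z P, ← Set.inter_union_sdiff Z' P, heq.1, heq.2]
  · rintro ⟨S, D⟩ hx
    obtain ⟨hx1, hx2⟩ := Set.mem_prod.mp hx
    dsimp only at hx1 hx2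
    obtain ⟨hSP, hSs⟩ := hx1
    obtain ⟨hDE, hDk, hbD, hDs, hDc⟩ := hx2
    have hDfin : D.Finite := N.ground_finite.subset (hDE.trans Set.sdiff_subset)
    have hSfin : S.Finite := hPfin.subset hSP
    have hdj : Disjoint D S := by
      rw [Set.disjoint_left]; intro x hxD hxS; exact (hDE hxD).2 (hSP hxS)
    have hSne : S.Nonempty := by rw [← Set.ncard_pos hSfin]; omega
    have hPSne : (P \ S).Nonempty := by
      by_contra hemp
      rw [Set.not_nonempty_iff_eq_empty, Set.sdiff_eq_empty] at hemp
      have := Set.ncard_le_ncard hemp hSfin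
      omega
    obtain ⟨hi, hd⟩ := union_inter_eq_and_sdiff_eq N hDE hSP
    refine ⟨D ∪ S, ⟨⟨Set.union_subset (hDE.trans Set.sdiff_subset) (hSP.trans hPE), ?_, ?_, ?_⟩,
      ?_, by rw [hi, hSs]⟩, ?_⟩
    · rw [Set.ncard_union_eq hdj hDfin hSfin, hDk, hSs]; omega
    · exact (spanning_union_iff_insert N hnl hpnl hSP hSne (hDE.trans Set.sdiff_subset)).mpr hDs
    · rw [compl_union_eq N hPE hDE hSP]
      exact (spanning_union_iff_insert N hnl hpnl Set.sdiff_subset hPSne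
        (Set.sdiff_subset.trans Set.sdiff_subset)).mpr hDc
    · rintro (h | h)
      · exact hbD h
      · exact hbP (hSP h)
    · simp only [Prod.mk.injEq]; exact ⟨hi, hd⟩

/-- **THE TOP PIECE, THROUGH `b`**: the through-`b` bi-spanning `k`-sets containing the whole class are in
bijection with `g_{k−q}^{sp}` by `W ↦ W ∖ P` (the complement has no element of the class left, so it must span
without `p`). -/
theorem pieceThrough_top_ncard (hnl : ∀ e ∈ N.E, N.IsNonloop e) {p : α} (hp : p ∈ N.E) {b : α}
    (hbP : b ∉ N.closure {p}) {k : ℕ} (hqk : (N.closure {p}).ncard ≤ k) :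
    (pieceThrough N p b k (N.closure {p}).ncard).ncard = (throughSp N p b (k - (N.closure {p}).ncard)).ncard := by
  classical
  set P := N.closure {p} with hPdef
  have hPE : P ⊆ N.E := N.closure_subset_ground _
  have hpP : p ∈ P := N.mem_closure_of_mem' rfl hp
  have hpnl : N.IsNonloop p := hnl p hp
  have hPfin : P.Finite := N.ground_finite.subset hPE
  refine Set.ncard_congr (fun W _ => W \ P) ?_ ?_ ?_
  · rintro W ⟨⟨hWE, hWk, hWs, hWc⟩, hbW, hWP⟩
    rw [← hPdef] at hWP
    have hWfin : W.Finite := N.ground_finite.subset hWE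
    have hPW : P ⊆ W := by
      have h := Set.eq_of_subset_of_ncard_le Set.inter_subset_right (by rw [hWP]) hPfin
      intro x hx; rw [← h] at hx; exact hx.1
    refine ⟨fun y hy => ⟨hWE hy.1, hy.2⟩, ?_, ⟨hbW, hbP⟩, ?_, ?_⟩
    · rw [Set.ncard_sdiff hPW hPfin, hWk]
    · have hW' : W = (W \ P) ∪ P := by rw [Set.sdiff_union_of_subset hPW]
      rw [hW'] at hWs
      exact (spanning_union_iff_insert N hnl hpnl (subset_refl P) ⟨p, hpP⟩ (Set.sdiff_subset.trans hWE)).mp hWs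
    · have : N.E \ W = (N.E \ P) \ (W \ P) := by
        ext y; simp only [Set.mem_sdiff, not_and, not_not]
        constructor
        · rintro ⟨hyE, hyW⟩; exact ⟨⟨hyE, fun hyP => hyW (hPW hyP)⟩, fun h => absurd h hyW⟩
        · rintro ⟨⟨hyE, hyP⟩, h⟩; exact ⟨hyE, fun hyW => hyP (h hyW)⟩
      rw [this] at hWc; exact hWc
  · intro W W' hW hW' heq
    obtain ⟨⟨hWE, hWk, -, -⟩, -, hWP⟩ := hW
    obtain ⟨⟨hW'E, -, -, -⟩, -, hW'P⟩ := hW'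
    rw [← hPdef] at hWP hW'P
    have hPW : P ⊆ W := by
      have h := Set.eq_of_subset_of_ncard_le Set.inter_subset_right (by rw [hWP]) hPfin
      intro x hx; rw [← h] at hx; exact hx.1
    have hPW' : P ⊆ W' := by
      have h := Set.eq_of_subset_of_ncard_le Set.inter_subset_right (by rw [hW'P]) hPfin
      intro x hx; rw [← h] at hx; exact hx.1
    rw [← Set.sdiff_union_of_subset hPW, ← Set.sdiff_union_of_subset hPW', heq]
  · rintro U ⟨hUE, hUk, hbU, hUs, hUc⟩
    have hUfin : U.Finite := N.ground_finite.subset (hUE.trans Set.sdiff_subset)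
    have hdj : Disjoint U P := by
      rw [Set.disjoint_left]; intro x hxU hxP; exact (hUE hxU).2 hxP
    obtain ⟨hi, hd⟩ := union_inter_eq_and_sdiff_eq N hUE (subset_refl P)
    refine ⟨U ∪ P, ⟨⟨Set.union_subset (hUE.trans Set.sdiff_subset) hPE, ?_, ?_, ?_⟩, Or.inl hbU,
      by rw [hi]⟩, hd⟩
    · rw [Set.ncard_union_eq hdj hUfin hPfin, hUk]; omega
    · exact (spanning_union_iff_insert N hnl hpnl (subset_refl P) ⟨p, hpP⟩ (hUE.trans Set.sdiff_subset)).mpr hUs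
    · rw [compl_union_eq N hPE hUE (subset_refl P), Set.sdiff_self, Set.union_empty]
      exact hUc

/-- **THE TOP PIECE, AVOIDING `b`**: the avoid-`b` bi-spanning `k`-sets containing the whole class are in
bijection with `ḡ_{k−q}^{sp}` by `Z ↦ Z ∖ P`. -/
theorem pieceAvoid_top_ncard (hnl : ∀ e ∈ N.E, N.IsNonloop e) {p : α} (hp : p ∈ N.E) {b : α}
    (hbP : b ∉ N.closure {p}) {k : ℕ} (hqk : (N.closure {p}).ncard ≤ k) :
    (pieceAvoid N p b k (N.closure {p}).ncard).ncard = (avoidSp N p b (k - (N.closure {p}).ncard)).ncard := by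
  classical
  set P := N.closure {p} with hPdef
  have hPE : P ⊆ N.E := N.closure_subset_ground _
  have hpP : p ∈ P := N.mem_closure_of_mem' rfl hp
  have hpnl : N.IsNonloop p := hnl p hp
  have hPfin : P.Finite := N.ground_finite.subset hPE
  refine Set.ncard_congr (fun Z _ => Z \ P) ?_ ?_ ?_
  · rintro Z ⟨⟨hZE, hZk, hZs, hZc⟩, hbZ, hZP⟩
    rw [← hPdef] at hZP
    have hPZ : P ⊆ Z := by
      have h := Set.eq_of_subset_of_ncard_le Set.inter_subset_right (by rw [hZP]) hPfin
      intro x hx; rw [← h] at hx; exact hx.1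
    refine ⟨fun y hy => ⟨hZE hy.1, hy.2⟩, ?_, fun h => hbZ h.1, ?_, ?_⟩
    · rw [Set.ncard_sdiff hPZ hPfin, hZk]
    · have hZ' : Z = (Z \ P) ∪ P := by rw [Set.sdiff_union_of_subset hPZ]
      rw [hZ'] at hZs
      exact (spanning_union_iff_insert N hnl hpnl (subset_refl P) ⟨p, hpP⟩ (Set.sdiff_subset.trans hZE)).mp hZs
    · have : N.E \ Z = (N.E \ P) \ (Z \ P) := by
        ext y; simp only [Set.mem_sdiff, not_and, not_not]
        constructor
        · rintro ⟨hyE, hyZ⟩; exact ⟨⟨hyE, fun hyP => hyZ (hPZ hyP)⟩, fun h => absurd h hyZ⟩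
        · rintro ⟨⟨hyE, hyP⟩, h⟩; exact ⟨hyE, fun hyZ => hyP (h hyZ)⟩
      rw [this] at hZc; exact hZc
  · intro Z Z' hZ hZ' heq
    obtain ⟨⟨hZE, -, -, -⟩, -, hZP⟩ := hZ
    obtain ⟨⟨hZ'E, -, -, -⟩, -, hZ'P⟩ := hZ'
    rw [← hPdef] at hZP hZ'P
    have hPZ : P ⊆ Z := by
      have h := Set.eq_of_subset_of_ncard_le Set.inter_subset_right (by rw [hZP]) hPfin
      intro x hx; rw [← h] at hx; exact hx.1
    have hPZ' : P ⊆ Z' := by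
      have h := Set.eq_of_subset_of_ncard_le Set.inter_subset_right (by rw [hZ'P]) hPfin
      intro x hx; rw [← h] at hx; exact hx.1
    rw [← Set.sdiff_union_of_subset hPZ, ← Set.sdiff_union_of_subset hPZ', heq]
  · rintro D ⟨hDE, hDk, hbD, hDs, hDc⟩
    have hDfin : D.Finite := N.ground_finite.subset (hDE.trans Set.sdiff_subset)
    have hdj : Disjoint D P := by
      rw [Set.disjoint_left]; intro x hxD hxP; exact (hDE hxD).2 hxP
    obtain ⟨hi, hd⟩ := union_inter_eq_and_sdiff_eq N hDE (subset_refl P)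
    refine ⟨D ∪ P, ⟨⟨Set.union_subset (hDE.trans Set.sdiff_subset) hPE, ?_, ?_, ?_⟩, ?_, by rw [hi]⟩, hd⟩
    · rw [Set.ncard_union_eq hdj hDfin hPfin, hDk]; omega
    · exact (spanning_union_iff_insert N hnl hpnl (subset_refl P) ⟨p, hpP⟩ (hDE.trans Set.sdiff_subset)).mpr hDs
    · rw [compl_union_eq N hPE hDE (subset_refl P), Set.sdiff_self, Set.union_empty]
      exact hDc
    · rintro (h | h)
      · exact hbD h
      · exact hbP h

/-- **THE ZERO PIECE, THROUGH `b`, IS THE MIXED FAMILY**: `pieceThrough k 0 = upFull k`. -/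
theorem pieceThrough_zero (hnl : ∀ e ∈ N.E, N.IsNonloop e) {p : α} (hp : p ∈ N.E) (b : α) (k : ℕ) :
    pieceThrough N p b k 0 = upFull N p b k := by
  classical
  set P := N.closure {p} with hPdef
  have hPE : P ⊆ N.E := N.closure_subset_ground _
  have hpP : p ∈ P := N.mem_closure_of_mem' rfl hp
  have hpnl : N.IsNonloop p := hnl p hp
  ext W
  constructor
  · rintro ⟨⟨hWE, hWk, hWs, hWc⟩, hbW, hWP⟩
    rw [← hPdef] at hWP
    have hWfin : W.Finite := N.ground_finite.subset hWE
    have hWP' : W ∩ P = ∅ := (Set.ncard_eq_zero (hWfin.subset Set.inter_subset_left)).mp hWP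
    refine ⟨fun x hx => ⟨hWE hx, fun hxP => ?_⟩, hWk, hbW, hWs, ?_⟩
    · have : x ∈ W ∩ P := ⟨hx, hxP⟩
      rw [hWP'] at this; exact this
    · rw [compl_eq_union_of_disjoint N hPE hWP'] at hWc
      exact (spanning_union_iff_insert N hnl hpnl (X := (N.E \ P) \ W) (subset_refl P) ⟨p, hpP⟩
        (Set.sdiff_subset.trans Set.sdiff_subset)).mp hWc
  · rintro ⟨hWE, hWk, hbW, hWs, hWc⟩
    have hWP : W ∩ P = ∅ := inter_eq_empty_of_subset_compl N hWE
    refine ⟨⟨hWE.trans Set.sdiff_subset, hWk, hWs, ?_⟩, hbW, by rw [← hPdef, hWP, Set.ncard_empty]⟩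
    rw [compl_eq_union_of_disjoint N hPE hWP]
    exact (spanning_union_iff_insert N hnl hpnl (X := (N.E \ P) \ W) (subset_refl P) ⟨p, hpP⟩
      (Set.sdiff_subset.trans Set.sdiff_subset)).mpr hWc

/-- **THE ZERO PIECE, AVOIDING `b`, IS THE MIXED FAMILY**: `pieceAvoid k 0 = avoidFull k`. -/
theorem pieceAvoid_zero (hnl : ∀ e ∈ N.E, N.IsNonloop e) {p : α} (hp : p ∈ N.E) (b : α) (k : ℕ) :
    pieceAvoid N p b k 0 = avoidFull N p b k := by
  classical
  set P := N.closure {p} with hPdef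
  have hPE : P ⊆ N.E := N.closure_subset_ground _
  have hpP : p ∈ P := N.mem_closure_of_mem' rfl hp
  have hpnl : N.IsNonloop p := hnl p hp
  ext Z
  constructor
  · rintro ⟨⟨hZE, hZk, hZs, hZc⟩, hbZ, hZP⟩
    rw [← hPdef] at hZP
    have hZfin : Z.Finite := N.ground_finite.subset hZE
    have hZP' : Z ∩ P = ∅ := (Set.ncard_eq_zero (hZfin.subset Set.inter_subset_left)).mp hZP
    refine ⟨fun x hx => ⟨hZE hx, fun hxP => ?_⟩, hZk, hbZ, hZs, ?_⟩
    · have : x ∈ Z ∩ P := ⟨hx, hxP⟩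
      rw [hZP'] at this; exact this
    · rw [compl_eq_union_of_disjoint N hPE hZP'] at hZc
      exact (spanning_union_iff_insert N hnl hpnl (X := (N.E \ P) \ Z) (subset_refl P) ⟨p, hpP⟩
        (Set.sdiff_subset.trans Set.sdiff_subset)).mp hZc
  · rintro ⟨hZE, hZk, hbZ, hZs, hZc⟩
    have hZP : Z ∩ P = ∅ := inter_eq_empty_of_subset_compl N hZE
    refine ⟨⟨hZE.trans Set.sdiff_subset, hZk, hZs, ?_⟩, hbZ, by rw [← hPdef, hZP, Set.ncard_empty]⟩
    rw [compl_eq_union_of_disjoint N hPE hZP]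
    exact (spanning_union_iff_insert N hnl hpnl (X := (N.E \ P) \ Z) (subset_refl P) ⟨p, hpP⟩
      (Set.sdiff_subset.trans Set.sdiff_subset)).mpr hZc

end PercRepro
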